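import Summits.HubbardSuperconductivity.HubbardSuperconductivity.Theorems.WcbcsSsbToTorusLRO.Negative.SummitMatrixUniformFloor

/-!
# Crux `WcbcsSsbToTorusLRO` (item `stmt-HubbardSuperconductivity-2009`): EVERY ground state versus SOME ground state —
the exact bookkeeping, support from the standing disprover (generation 5)

The summit matrix `HasDWavePairFieldLROAt U δ` is an EVERY-ground-state statement (uniform floor under the pair
intensity `re⟨ψ, P†P ψ⟩`, `P = pairField dWaveFormFactor L`, of every normalised `(N_L, S^z = 0)` sector ground state
at every large even side — `hasDWavePairFieldLROAt_iff_floor`, file `SummitMatrixUniformFloor.lean`); sourced and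
quenched levers give at best SOME good state. On the literal objects, without definitions:

* `re_expect_pairIntensity_smul`, `re_expect_pairIntensity_eq_of_smul` — the pair intensity is constant on the unit
  vectors of a complex line; hence `re_expect_pairIntensity_eq_of_simple`: if all sector ground vectors are proportional
  (SIMPLICITY of the sector ground state), every two normalised ground states have the same pair intensity (spread `0`;
  the multiplicity-free generalisation is `SchurRigidity.lean`);
* `floor_of_spread_of_someFloor` — a SPREAD bound `re⟨ψ', P†P ψ'⟩ - re⟨ψ, P†P ψ⟩ ≤ (a/2)·L⁴` over pairs of normalised
  ground states at all large even sides, plus a floor `a·L⁴` under SOME normalised ground state eventually along the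
  sides `2k+2`, give the every-ground-state floor `(a/2)·L⁴`; with `hasDWavePairFieldLROAt_of_floor`:
  `hasDWavePairFieldLROAt_of_spread_of_someFloor`;
* `someFloor_of_hasDWavePairFieldLROAt` — conversely the matrix returns the some-ground-state floor (`δ ≥ 0`), but NOT a
  spread bound: the matrix tolerates any spread as long as the minimum stays positive (rigidity is not necessary for the
  crux, only the floor is).

Workfile: `Cruxes/WcbcsSsbToTorusLRO/DisproofRound2.lean` §18. Elementary. [folklore]
-/

noncomputable section

namespace Summit.HubbardSuperconductivity.WcbcsSsbToTorusLRO.Negative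

open Matrix Literature.MathematicalPhysics.QuantumLattice Literature.Barriers.HubbardSuperconductivity Filter
open scoped Matrix ComplexOrder

variable (L : ℕ) [NeZero L]

/-- `re⟨cφ, P†P (cφ)⟩ = |c|² re⟨φ, P†P φ⟩`. [folklore] -/
theorem re_expect_pairIntensity_smul (c : ℂ) (φ : Fock (Orb (FermionTorus 2 L))) :
    (expect ((pairField dWaveFormFactor L)ᴴ * pairField dWaveFormFactor L) (c • φ)).re =
      ‖c‖ ^ 2 * (expect ((pairField dWaveFormFactor L)ᴴ * pairField dWaveFormFactor L) φ).re := by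
  unfold expect
  rw [Matrix.mulVec_smul, star_smul, smul_dotProduct, dotProduct_smul, smul_smul, smul_eq_mul, Complex.star_def,
    Complex.conj_mul', ← Complex.ofReal_pow, Complex.re_ofReal_mul]

omit [NeZero L] in
/-- `‖cφ‖² = |c|² ‖φ‖²` in the `star`-dot form. [folklore] -/
theorem star_smul_dotProduct_smul (c : ℂ) (φ : Fock (Orb (FermionTorus 2 L))) :
    star (c • φ) ⬝ᵥ (c • φ) = ((‖c‖ ^ 2 : ℝ) : ℂ) * (star φ ⬝ᵥ φ) := by
  rw [star_smul, smul_dotProduct, dotProduct_smul, smul_smul, smul_eq_mul, Complex.star_def, Complex.conj_mul',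
    Complex.ofReal_pow]

/-- Two unit vectors on the same complex line have the same pair intensity. [folklore] -/
theorem re_expect_pairIntensity_eq_of_smul {c : ℂ} {ψ ψ' : Fock (Orb (FermionTorus 2 L))}
    (hψ : star ψ ⬝ᵥ ψ = 1) (hψ' : star ψ' ⬝ᵥ ψ' = 1) (h : ψ' = c • ψ) :
    (expect ((pairField dWaveFormFactor L)ᴴ * pairField dWaveFormFactor L) ψ').re =
      (expect ((pairField dWaveFormFactor L)ᴴ * pairField dWaveFormFactor L) ψ).re := by
  have hc : ‖c‖ ^ 2 = 1 := by
    rw [h, star_smul_dotProduct_smul, hψ, mul_one] at hψ'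
    exact_mod_cast hψ'
  rw [h, re_expect_pairIntensity_smul, hc, one_mul]

/-- **Simplicity ⇒ spread `0`**: if all `(N, S^z = 0)` sector ground vectors of `hubbardTorus 2 L 1 U` are proportional,
every two normalised ground states have the same pair intensity. [folklore] -/
theorem re_expect_pairIntensity_eq_of_simple {U : ℝ} {N : ℕ}
    (hs : ∀ ψ ψ' : Fock (Orb (FermionTorus 2 L)), IsGroundStateInSector (hubbardTorus 2 L 1 U) N 0 ψ →
      IsGroundStateInSector (hubbardTorus 2 L 1 U) N 0 ψ' → ∃ c : ℂ, ψ' = c • ψ)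
    {ψ ψ' : Fock (Orb (FermionTorus 2 L))} (hψ : IsGroundStateInSector (hubbardTorus 2 L 1 U) N 0 ψ)
    (hψ1 : star ψ ⬝ᵥ ψ = 1) (hψ' : IsGroundStateInSector (hubbardTorus 2 L 1 U) N 0 ψ') (hψ'1 : star ψ' ⬝ᵥ ψ' = 1) :
    (expect ((pairField dWaveFormFactor L)ᴴ * pairField dWaveFormFactor L) ψ').re =
      (expect ((pairField dWaveFormFactor L)ᴴ * pairField dWaveFormFactor L) ψ).re := by
  obtain ⟨c, hc⟩ := hs ψ ψ' hψ hψ'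
  exact re_expect_pairIntensity_eq_of_smul L hψ1 hψ'1 hc

omit [NeZero L] in
/-- **Spread + some-GS floor ⇒ every-GS floor.** A spread bound `(a/2)·L⁴` over pairs of normalised sector ground
states at all large even sides, and a floor `a·L⁴` under SOME normalised ground state eventually along the sides
`2k+2`, give the floor `(a/2)·L⁴` under EVERY normalised ground state eventually. [folklore] -/
theorem floor_of_spread_of_someFloor {U δ a : ℝ}
    (hspread : ∃ L₀ : ℕ, ∀ (L : ℕ) [NeZero L], L₀ ≤ L → Even L → ∀ ψ ψ' : Fock (Orb (FermionTorus 2 L)),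
      IsGroundStateInSector (hubbardTorus 2 L 1 U) (2 * ⌊(1 - δ) * ((L : ℕ) : ℝ) ^ 2 / 2⌋₊) 0 ψ → star ψ ⬝ᵥ ψ = 1 →
      IsGroundStateInSector (hubbardTorus 2 L 1 U) (2 * ⌊(1 - δ) * ((L : ℕ) : ℝ) ^ 2 / 2⌋₊) 0 ψ' → star ψ' ⬝ᵥ ψ' = 1 →
        (expect ((pairField dWaveFormFactor L)ᴴ * pairField dWaveFormFactor L) ψ').re -
          (expect ((pairField dWaveFormFactor L)ᴴ * pairField dWaveFormFactor L) ψ).re ≤ a / 2 * ((L : ℕ) : ℝ) ^ 4)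
    (hsome : ∀ᶠ k : ℕ in atTop, ∃ ψ : Fock (Orb (FermionTorus 2 (2 * k + 1 + 1))),
      IsGroundStateInSector (hubbardTorus 2 (2 * k + 1 + 1) 1 U) (2 * ⌊(1 - δ) * (((2 * k + 1 + 1) : ℕ) : ℝ) ^ 2 / 2⌋₊) 0 ψ ∧
      star ψ ⬝ᵥ ψ = 1 ∧
      a * ((2 * k + 1 + 1 : ℕ) : ℝ) ^ 4 ≤ (expect ((pairField dWaveFormFactor (2 * k + 1 + 1))ᴴ * pairField dWaveFormFactor (2 * k + 1 + 1)) ψ).re) :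
    ∀ᶠ k : ℕ in atTop, ∀ ψ' : Fock (Orb (FermionTorus 2 (2 * k + 1 + 1))),
      IsGroundStateInSector (hubbardTorus 2 (2 * k + 1 + 1) 1 U) (2 * ⌊(1 - δ) * (((2 * k + 1 + 1) : ℕ) : ℝ) ^ 2 / 2⌋₊) 0 ψ' → star ψ' ⬝ᵥ ψ' = 1 →
        a / 2 * ((2 * k + 1 + 1 : ℕ) : ℝ) ^ 4 ≤ (expect ((pairField dWaveFormFactor (2 * k + 1 + 1))ᴴ * pairField dWaveFormFactor (2 * k + 1 + 1)) ψ').re := by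
  obtain ⟨L₀, hL⟩ := hspread
  filter_upwards [hsome, eventually_ge_atTop L₀] with k hk hkL₀
  intro ψ' hψ' hψ'1
  obtain ⟨ψ, hψ, hψ1, hfloor⟩ := hk
  have hle : L₀ ≤ 2 * k + 1 + 1 := by omega
  have heven : Even (2 * k + 1 + 1) := ⟨k + 1, by ring⟩
  have h := hL (2 * k + 1 + 1) hle heven ψ' ψ hψ' hψ'1 hψ hψ1
  linarith

omit [NeZero L] in
/-- Hence: spread bound + some-GS floor ⇒ the summit matrix at `(U, δ)` (through `hasDWavePairFieldLROAt_of_floor`). This is the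
shape a "uniqueness / multiplicity-freeness by-product of the weak-coupling construction" line would take. [folklore] -/
theorem hasDWavePairFieldLROAt_of_spread_of_someFloor {U δ a : ℝ} (ha : 0 < a)
    (hspread : ∃ L₀ : ℕ, ∀ (L : ℕ) [NeZero L], L₀ ≤ L → Even L → ∀ ψ ψ' : Fock (Orb (FermionTorus 2 L)),
      IsGroundStateInSector (hubbardTorus 2 L 1 U) (2 * ⌊(1 - δ) * ((L : ℕ) : ℝ) ^ 2 / 2⌋₊) 0 ψ → star ψ ⬝ᵥ ψ = 1 →
      IsGroundStateInSector (hubbardTorus 2 L 1 U) (2 * ⌊(1 - δ) * ((L : ℕ) : ℝ) ^ 2 / 2⌋₊) 0 ψ' → star ψ' ⬝ᵥ ψ' = 1 →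
        (expect ((pairField dWaveFormFactor L)ᴴ * pairField dWaveFormFactor L) ψ').re -
          (expect ((pairField dWaveFormFactor L)ᴴ * pairField dWaveFormFactor L) ψ).re ≤ a / 2 * ((L : ℕ) : ℝ) ^ 4)
    (hsome : ∀ᶠ k : ℕ in atTop, ∃ ψ : Fock (Orb (FermionTorus 2 (2 * k + 1 + 1))),
      IsGroundStateInSector (hubbardTorus 2 (2 * k + 1 + 1) 1 U) (2 * ⌊(1 - δ) * (((2 * k + 1 + 1) : ℕ) : ℝ) ^ 2 / 2⌋₊) 0 ψ ∧
      star ψ ⬝ᵥ ψ = 1 ∧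
      a * ((2 * k + 1 + 1 : ℕ) : ℝ) ^ 4 ≤ (expect ((pairField dWaveFormFactor (2 * k + 1 + 1))ᴴ * pairField dWaveFormFactor (2 * k + 1 + 1)) ψ).re) :
    HasDWavePairFieldLROAt U δ :=
  hasDWavePairFieldLROAt_of_floor ⟨a / 2, half_pos ha, floor_of_spread_of_someFloor hspread hsome⟩

omit [NeZero L] in
/-- Conversely the matrix returns the some-GS floor (`δ ≥ 0`: every-GS floor + non-emptiness of the sector) — but NOT a spread
bound. [folklore] -/
theorem someFloor_of_hasDWavePairFieldLROAt {U δ : ℝ} (hδ : 0 ≤ δ) (h : HasDWavePairFieldLROAt U δ) :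
    ∃ a : ℝ, 0 < a ∧ ∀ᶠ k : ℕ in atTop, ∃ ψ : Fock (Orb (FermionTorus 2 (2 * k + 1 + 1))),
      IsGroundStateInSector (hubbardTorus 2 (2 * k + 1 + 1) 1 U) (2 * ⌊(1 - δ) * (((2 * k + 1 + 1) : ℕ) : ℝ) ^ 2 / 2⌋₊) 0 ψ ∧
      star ψ ⬝ᵥ ψ = 1 ∧
      a * ((2 * k + 1 + 1 : ℕ) : ℝ) ^ 4 ≤ (expect ((pairField dWaveFormFactor (2 * k + 1 + 1))ᴴ * pairField dWaveFormFactor (2 * k + 1 + 1)) ψ).re := by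
  obtain ⟨a, ha, hev⟩ := floor_of_hasDWavePairFieldLROAt hδ h
  refine ⟨a, ha, ?_⟩
  filter_upwards [hev] with k hk
  obtain ⟨ψ, hψ1, hψ⟩ := exists_unit_groundStateInSector (2 * k + 1 + 1) U (halfFilling_floor_le_sq (2 * k + 1 + 1) hδ)
  exact ⟨ψ, hψ, hψ1, hk ψ hψ hψ1⟩

end Summit.HubbardSuperconductivity.WcbcsSsbToTorusLRO.Negative

end
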